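import Literature.NumberTheory.DiophantineGeometry.PastenValuationProductsProofs
import Literature.NumberTheory.DiophantineGeometry.MinimalDiscriminantProofs
import HarnessLib

/-!
# Pasten's products of valuations — Theorem 16.5, first part: the printed proof from Corollary 16.2 and Mestre–Oesterlé

H. Pasten, *Shimura curves and the abc conjecture*, J. Number Theory 254 (2024) 214–335
(arXiv:1705.09251, held; §16.3, p. 50 of the arXiv text), Theorem 16.5 (= Theorem 1.12 and its
many-prime sharpening) and the opening of its proof:

> Let `ε > 0`. There is a number `K_ε > 0` depending only on `ε` such that the following holds:
> For every semi-stable elliptic curve `E` over `ℚ` we have `∏_{p ∣ N_E} v_p(Δ_E) < K_ε · N_E^{11/2+ε}`.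
> […] *Proof.* If `N_E = p` is prime then `v_p(Δ_E) ≤ 5` (cf. [MestreOesterle]). The first part
> of the result now follows from Corollary (CoroValGen) with `S = ∅`.

This file formalises exactly that paragraph over the vocabulary of `PastenValuationProducts.lean`:
`pasten_valuationProduct_semistable` (Thm 1.12) follows from the two EXISTING named facts
`pasten_valuationProduct_awayFrom` (Corollary 16.2 = "CoroValGen", constant form) and
Mestre–Oesterlé for prime conductor (`Literature.NumberTheory.EllipticCurves.mestreOesterle_factorization_le_five`,
equivalently `mestreOesterle1989_thm_1` of `ValuationProductElliptic.lean`):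

* `WeierstrassCurve.isSemistable_iff_conductorExponent_le_one_rat` — over `ℚ`, semistable iff
  `f_v ≤ 1` everywhere (the tree lemma `isSemistable_iff_conductorExponent_le_one` with its two
  fact-hypotheses discharged by `conductorExponent_eq_zero_iff_holds` / `…_eq_one_iff_holds`);
* `mestreOesterle_factorization_le_five_of_thm_1` — `Δ_min ∣ N_E^5` gives `v_p(Δ_E) ≤ 5` for
  prime `N_E = p`;
* `valuationProduct_le_five_of_card_primeFactors_le_one` — at most one bad prime: the product is
  empty (`N_E = 1`) or `v_p(Δ_E) ≤ 5` (`N_E = p`);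
* `pasten_valuationProduct_semistable_of_awayFrom`, `…_of_awayFrom_of_mestreOesterle` — the
  printed deduction, constant `max K_{∅,ε} 6`;
* (p41107's sixth declaration, `pasten_thm_1_12_iff`, is the sibling file's
  `pasten_thm_1_12_iff_valuationProduct` verbatim and is not repeated.)

Provenance: these declarations were first landed in the sibling target
`PastenValuationProductsProofs.lean` by proposal p41107 (the `provefact` seat on
`pasten_valuationProduct_semistable`) and were dropped when a concurrent whole-file landing of the
same target (p41499, the seat on `…_manyPrimes`, author of this file) replaced it; they are
restored here with p41107's names and statements, re-proved, in a file of their own so that no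
further whole-file landing of the shared target can drop them. Everything is proved; no
definition, no new named fact (D-0026).

What is NOT here: proofs of Corollary 16.2 (from Theorem 16.1: Shimura-curve parametrisations,
Jacquet–Langlands and modularity, refined Ribet–Takahashi, Arakelov bounds for `δ_{D,M}`) or of
Mestre–Oesterlé's theorem (modular parametrisations, Weil pairing on `E[m]`); the discharge
`pasten_valuationProduct_semistable_holds` stays blocked on those two named facts.

## References

* [PastenShimura2024] H. Pasten, *Shimura curves and the abc conjecture*, J. Number Theory 254
  (2024) 214–335, doi:10.1016/j.jnt.2023.07.002, arXiv:1705.09251 — §16.3 Theorem 16.5 and its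
  proof, first part (p. 50 of the held copy); Theorem 1.12; §16.1 Corollary 16.2.
* [MestreOesterle1989] J.-F. Mestre, J. Oesterlé, *Courbes de Weil semi-stables de discriminant
  une puissance m-ième*, J. reine angew. Math. 400 (1989) 173–184, Théorème 1.
* [Silverman1994] J. H. Silverman, *Advanced Topics in the Arithmetic of Elliptic Curves*,
  GTM 151, 1994, Thm IV.10.2.
-/

noncomputable section

open IsDedekindDomain Rat.HeightOneSpectrum

namespace WeierstrassCurve

/-- Over `ℚ`, an elliptic `W` is semistable iff `f_v ≤ 1` at every finite place `v` of `ℤ`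
(Silverman ATAEC IV.10.2 (a),(b): `f_v = 0` iff good, `f_v = 1` iff multiplicative reduction):
the tree lemma `isSemistable_iff_conductorExponent_le_one` with its two fact-hypotheses
discharged by `conductorExponent_eq_zero_iff_holds`, `conductorExponent_eq_one_iff_holds` (the
residue fields `𝔽_p` are finite, hence perfect). (Deliberate dot-notation extension of the
Mathlib namespace `WeierstrassCurve`; statement and name as first landed by p41107.)
[cite: Silverman1994, IV.10.2] -/
theorem isSemistable_iff_conductorExponent_le_one_rat (W : WeierstrassCurve ℚ) [W.IsElliptic] :
    W.IsSemistable ℤ ↔ ∀ v : HeightOneSpectrum ℤ, W.conductorExponent v ≤ 1 :=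
  W.isSemistable_iff_conductorExponent_le_one ℤ
    (fun v ↦ conductorExponent_eq_zero_iff_holds v W)
    (fun v ↦ conductorExponent_eq_one_iff_holds v W)

end WeierstrassCurve

namespace Literature.NumberTheory.DiophantineGeometry

/-- The two tree renderings of **Mestre–Oesterlé for prime conductor** agree in the direction
used by Pasten: `mestreOesterle1989_thm_1` of `ValuationProductElliptic.lean` ("`N_E = p` prime
`⟹ Δ_min ∣ N_E ^ 5`") gives `Literature.NumberTheory.EllipticCurves.mestreOesterle_factorization_le_five`
("`N_E = p` prime `⟹ v_p(Δ_E) ≤ 5`"), since `|Δ_min| ≠ 0` (`minimalDiscriminantNorm_pos_holds`).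
This is the sentence "If `N_E = p` is prime then `v_p(Δ_E) ≤ 5` (cf. [MestreOesterle])" opening
Pasten's proof of Theorem 16.5. (Statement and name as first landed by p41107.)
[cite: MestreOesterle1989, Théorème 1 (via PastenShimura2024 §16.3)] -/
theorem mestreOesterle_factorization_le_five_of_thm_1 (h : mestreOesterle1989_thm_1) :
    Literature.NumberTheory.EllipticCurves.mestreOesterle_factorization_le_five := by
  intro W _ hp
  have hΔ : 0 < W.minimalDiscriminantNorm ℤ := WeierstrassCurve.minimalDiscriminantNorm_pos_holds W
  exact mestreOesterle1989_thm_1.factorization_le h W hp hΔ.ne'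

/-- **At most one bad prime ⟹ `∏_{p ∣ N_E} v_p(Δ_E) ≤ 5`**: if `N_E` is squarefree with at
most one prime factor then either `N_E = 1` (empty product, `= 1`) or `N_E = p` is prime and the
product is `v_p(Δ_E) ≤ 5` by Mestre–Oesterlé (hypothesis `h5`, the named fact
`Literature.NumberTheory.EllipticCurves.mestreOesterle_factorization_le_five`). The case split
opening Pasten's proof of Theorem 16.5. (Statement and name as first landed by p41107.)
[cite: PastenShimura2024, Theorem 16.5 (arXiv numbering), proof, first part] -/
theorem valuationProduct_le_five_of_card_primeFactors_le_one
    (h5 : Literature.NumberTheory.EllipticCurves.mestreOesterle_factorization_le_five)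
    (W : WeierstrassCurve ℚ) [W.IsElliptic] (hsq : Squarefree (W.conductorNorm ℤ))
    (hcard : (W.conductorNorm ℤ).primeFactors.card ≤ 1) : valuationProduct W ≤ 5 := by
  rw [valuationProduct_def]
  rcases Nat.le_one_iff_eq_zero_or_eq_one.mp hcard with h0 | h1
  · rw [Finset.card_eq_zero.mp h0, Finset.prod_empty]
    norm_num
  · obtain ⟨p, hp⟩ := Finset.card_eq_one.mp h1
    have hpmem : p ∈ (W.conductorNorm ℤ).primeFactors := by
      rw [hp]
      exact Finset.mem_singleton_self p
    have hpN : W.conductorNorm ℤ = p := by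
      have hprod := Nat.prod_primeFactors_of_squarefree hsq
      rw [hp, Finset.prod_singleton] at hprod
      exact hprod.symm
    have hprime : (W.conductorNorm ℤ).Prime := by
      rw [hpN]
      exact Nat.prime_of_mem_primeFactors hpmem
    have hle := h5 W hprime
    rw [hpN] at hle
    rw [hp, Finset.prod_singleton]
    exact hle

/-- **Pasten's printed proof of Theorem 16.5, first part** (= Theorem 1.12; arXiv:1705.09251,
§16.3, p. 50): "If `N_E = p` is prime then `v_p(Δ_E) ≤ 5` (cf. [MestreOesterle]). The first
part of the result now follows from Corollary (CoroValGen) with `S = ∅`." Formally: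
`pasten_valuationProduct_semistable` from the EXISTING named facts
`pasten_valuationProduct_awayFrom` (Cor. 16.2, hypothesis `h162`, taken at `S = ∅`: a semistable
`E` has squarefree `N_E` by `WeierstrassCurve.isSemistable_iff_squarefree_conductorNorm`, so every
bad prime is multiplicative and the filtered product is the full one,
`prod_filter_eq_valuationProduct_of_squarefree`) when `E` has `≥ 2` bad primes, and
Mestre–Oesterlé (hypothesis `h5`, via `valuationProduct_le_five_of_card_primeFactors_le_one`)
when it has `≤ 1`; the constant is `max K_{∅,ε} 6` (using `N_E ≥ 1`, `conductorNorm_pos_holds`).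
(Statement and name as first landed by p41107.)
[cite: PastenShimura2024, Theorem 16.5 (arXiv numbering), proof, first part] -/
theorem pasten_valuationProduct_semistable_of_awayFrom (h162 : pasten_valuationProduct_awayFrom)
    (h5 : Literature.NumberTheory.EllipticCurves.mestreOesterle_factorization_le_five) :
    pasten_valuationProduct_semistable := by
  intro ε hε
  obtain ⟨K, hK, hKW⟩ := h162 ∅ ε hε
  refine ⟨max K 6, lt_max_of_lt_left hK, fun W _ hss ↦ ?_⟩
  have hsq : Squarefree (W.conductorNorm ℤ) :=
    (W.isSemistable_iff_squarefree_conductorNorm).mp hss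
  have hN0 : W.conductorNorm ℤ ≠ 0 := (W.conductorNorm_pos_holds).ne'
  have hN0' : (0 : ℝ) ≤ (W.conductorNorm ℤ : ℝ) := Nat.cast_nonneg _
  have hN1 : (1 : ℝ) ≤ (W.conductorNorm ℤ : ℝ) := by
    exact_mod_cast Nat.one_le_iff_ne_zero.mpr hN0
  have hr0 : (0 : ℝ) ≤ (W.conductorNorm ℤ : ℝ) ^ ((11 : ℝ) / 2 + ε) := Real.rpow_nonneg hN0' _
  have hr1 : (1 : ℝ) ≤ (W.conductorNorm ℤ : ℝ) ^ ((11 : ℝ) / 2 + ε) :=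
    Real.one_le_rpow hN1 (by positivity)
  have hK6 : (0 : ℝ) ≤ max K 6 := le_trans (by norm_num) (le_max_right K 6)
  by_cases hcard : 2 ≤ (W.conductorNorm ℤ).primeFactors.card
  · -- `≥ 2` bad primes: Corollary 16.2 with `S = ∅`
    have hS : ∀ p : ℕ, p.Prime → p ∉ (∅ : Finset ℕ) → ¬ p ^ 2 ∣ W.conductorNorm ℤ :=
      fun p hp _ h2 ↦ hp.not_isUnit (hsq p (by simpa [sq] using h2))
    have hfilter : ((W.conductorNorm ℤ).primeFactors.filter
        fun p => ¬ p ^ 2 ∣ W.conductorNorm ℤ) = (W.conductorNorm ℤ).primeFactors :=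
      Finset.filter_true_of_mem fun p hp ↦
        hS p (Nat.prime_of_mem_primeFactors hp) (Finset.notMem_empty p)
    have h2 : 2 ≤ ((W.conductorNorm ℤ).primeFactors.filter
        fun p => ¬ p ^ 2 ∣ W.conductorNorm ℤ).card := by
      rwa [hfilter]
    have hlt := hKW W hS h2
    rw [prod_filter_eq_valuationProduct_of_squarefree W hsq] at hlt
    exact hlt.trans_le (mul_le_mul_of_nonneg_right (le_max_left K 6) hr0)
  · -- `≤ 1` bad prime: Mestre–Oesterlé
    have hle : valuationProduct W ≤ 5 :=
      valuationProduct_le_five_of_card_primeFactors_le_one h5 W hsq (by omega)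
    calc (valuationProduct W : ℝ) ≤ 5 := by exact_mod_cast hle
      _ < 6 := by norm_num
      _ ≤ max K 6 := le_max_right K 6
      _ ≤ max K 6 * (W.conductorNorm ℤ : ℝ) ^ ((11 : ℝ) / 2 + ε) :=
        le_mul_of_one_le_right hK6 hr1

/-- Pasten's printed proof of Theorem 16.5, first part, with Mestre–Oesterlé in the rendering
`mestreOesterle1989_thm_1` of `ValuationProductElliptic.lean` (`Δ_min ∣ N_E^5` for prime
conductor): `pasten_valuationProduct_semistable` from the existing named facts
`pasten_valuationProduct_awayFrom` and `mestreOesterle1989_thm_1`. (Statement and name as first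
landed by p41107.) [cite: PastenShimura2024, Theorem 16.5 (arXiv numbering), proof, first part] -/
theorem pasten_valuationProduct_semistable_of_awayFrom_of_mestreOesterle
    (h162 : pasten_valuationProduct_awayFrom) (hMO : mestreOesterle1989_thm_1) :
    pasten_valuationProduct_semistable :=
  pasten_valuationProduct_semistable_of_awayFrom h162
    (mestreOesterle_factorization_le_five_of_thm_1 hMO)

end Literature.NumberTheory.DiophantineGeometry

end
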